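import Summits.AtomisticToContinuum.BoseEinsteinCondensation.Theorems.BECThomsonPrincipleDensityResponseKineticVariation

/-!
# Route `BECThomsonPrinciple`, crux `DensityResponse` (stmt-AtomisticToContinuum-9481),
# line `force-balance-constitutive` — sub-goal `stub_transportCoercive` of stub S1
# (`TransportStationary`)

COERCIVITY OF THE KINETIC ENERGY ALONG THE TRANSPORT. For `L > 0`, a mode `n ≠ 0`, `N ≥ 1` and an
admissible periodic state `Φ`, the kinetic energy of the transported wave function
`Φ^τ = transportFun L n τ Φ.ψ` (`Theorems/BECThomsonPrincipleDensityResponseTransportState.lean`)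
blows up in both time directions, `∫_cell |∇Φ^τ|² → +∞` as `τ → ±∞`
(`tendsto_cellKineticEnergy_transportFun_atTop/atBot`): the flow squeezes `|Φ|²` onto the
attracting planes `cos θ₁ = ∓1` of the field `u_k`, and a squeezed density costs kinetic energy
(von Weizsäcker). Steps (no compactness):
* UNCERTAINTY LEMMA `ksq_mul_abs_integral_cos_le`: for an admissible `Ψ`, a particle `i` and
  `γ > 0`, `|k|² |∫ cos θᵢ |Ψ|²| ≤ γ ∫ sin² θᵢ |Ψ|² + (|k|²/γ) ∫ |∇Ψ|²` (torus integration by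
  parts `|k|² ∫ cos θᵢ |Ψ|² = -∫ sin θᵢ 2⟨Ψ, k·∇ᵢΨ⟩` of
  `Theorems/BECThomsonPrincipleDensityResponseKineticVariation.lean`, Young's inequality and
  `|k·∇ᵢΨ|² ≤ |k|²|∇Ψ|²`);
* FLATTENING (Bochner torus change of variables `integral_mul_norm_sq_transportFun`):
  `∫ cos θᵢ |Φ^τ|² = ∫ cos(θᵢ + δ(τ,θᵢ)) |Φ|²`, `∫ sin² θᵢ |Φ^τ|² = ∫ sin²(θᵢ + δ(τ,θᵢ)) |Φ|²`;
* COLLAPSE `G_±(τ) = ∫ (1 ± cos(θᵢ + δ(τ,θᵢ))) |Φ|² → 0` as `τ → ±∞` (dominated convergence; the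
  closed forms `1 ± cos(θ + δ) = 2(1 ± cos θ)/((1 ± cos θ) + e^{±2τ}(1 ∓ cos θ))` tend to `0` off
  the planes `sin θᵢ = 0`, the preimage of the countable set `πℤ` under the surjective linear
  phase functional, Lebesgue-null by `ae_comp_linearMap_mem_iff`);
* as `|∫ cos(θᵢ + δ)|Φ|²| ≥ 1 - G_±` and `∫ sin²(θᵢ + δ)|Φ|² ≤ 2G_±`, the uncertainty lemma for
  `Φ^τ` with `γ = max(B,0) + 1` gives `∫ |∇Φ^τ|² ≥ γ - G_±(γ + 2γ²/|k|²) ≥ B` eventually.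

The registered sub-goal `stub_transportCoercive` is the `ℝ≥0∞` form
`ofReal B ≤ ∫⁻_cell kineticDensity (Φ^τ)` for `τ ≥ T` and for `τ ≤ -T`. Elementary; no named facts.
-/

namespace Summit.AtomisticToContinuum.BoseEinsteinCondensation.Cruxes.DensityResponse.ForceBalanceConstitutive

noncomputable section

open Real MeasureTheory Filter Set
open scoped ENNReal Topology RealInnerProductSpace
open Literature.MathematicalPhysics.QuantumManyBody.BoseGas

variable {N : ℕ} {L : ℝ} {n : Fin 3 → ℤ}

/-! ### The uncertainty lemma -/

/-- Young's inequality for the source of the integration by parts: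
`|sin θ · 2⟨z, w⟩| ≤ γ sin² θ |z|² + |w|²/γ` (`γ > 0`). [folklore] -/
theorem abs_sin_mul_two_inner_le (s : ℝ) (z w : ℂ) {γ : ℝ} (hγ : 0 < γ) :
    |s * (2 * ⟪z, w⟫)| ≤ γ * (s ^ 2 * ‖z‖ ^ 2) + ‖w‖ ^ 2 / γ := by
  have hi := abs_real_inner_le_norm z w
  have h1 : |s * (2 * ⟪z, w⟫)| ≤ 2 * (|s| * ‖z‖) * ‖w‖ := by
    rw [abs_mul, abs_mul, abs_two]
    nlinarith [abs_nonneg s, norm_nonneg z, norm_nonneg w, abs_nonneg ⟪z, w⟫]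
  have h2 : γ * (|s| * ‖z‖) ^ 2 + ‖w‖ ^ 2 / γ - 2 * (|s| * ‖z‖) * ‖w‖ =
      (γ * (|s| * ‖z‖) - ‖w‖) ^ 2 / γ := by
    field_simp; ring
  have h3 : 0 ≤ (γ * (|s| * ‖z‖) - ‖w‖) ^ 2 / γ := div_nonneg (sq_nonneg _) hγ.le
  rw [mul_pow, sq_abs] at h2
  linarith

/-- **THE UNCERTAINTY LEMMA.** For an admissible periodic state `Ψ`, a particle `i` and `γ > 0`,
`|k|² |∫_cell cos θᵢ |Ψ|²| ≤ γ ∫_cell sin² θᵢ |Ψ|² + (|k|²/γ) ∫_cell |∇Ψ|²`: a density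
modulated along `k` either keeps weight off the planes `sin θᵢ = 0` or pays kinetic energy
(torus integration by parts `|k|² ∫ cos θᵢ |Ψ|² = -∫ sin θᵢ 2⟨Ψ, k·∇ᵢΨ⟩`, Young,
Cauchy–Schwarz). [folklore] -/
theorem ksq_mul_abs_integral_cos_le (hL : 0 < L) (n : Fin 3 → ℤ) (Ψ : PeriodicTrialState N L)
    (i : Fin N) {γ : ℝ} (hγ : 0 < γ) :
    ksq L n * |∫ X in cellN N L, cos (phase L n X i) * ‖Ψ.ψ X‖ ^ 2| ≤
      γ * (∫ X in cellN N L, sin (phase L n X i) ^ 2 * ‖Ψ.ψ X‖ ^ 2) +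
        ksq L n / γ * cellKineticEnergy L Ψ.ψ := by
  have hq : 0 ≤ ksq L n := ksq_nonneg L n
  have hd : Continuous (fderiv ℝ Ψ.ψ) := Ψ.contDiff.continuous_fderiv one_ne_zero
  have hK : Continuous fun Y : Config N => kDeriv L n Ψ.ψ Y i := hd.clm_apply continuous_const
  have hψc : Continuous Ψ.ψ := Ψ.contDiff.continuous
  have hθ : Continuous fun Y : Config N => phase L n Y i := continuous_phase L n i
  have hf : Continuous fun Y : Config N => cos (phase L n Y i) * ‖Ψ.ψ Y‖ ^ 2 := by fun_prop
  have hg : Continuous fun Y : Config N =>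
      sin (phase L n Y i) * (2 * ⟪Ψ.ψ Y, kDeriv L n Ψ.ψ Y i⟫) :=
    (continuous_sin.comp hθ).mul (continuous_const.mul (hψc.inner hK))
  have hS : Continuous fun Y : Config N => sin (phase L n Y i) ^ 2 * ‖Ψ.ψ Y‖ ^ 2 := by fun_prop
  have hD : Continuous fun Y : Config N => ‖kDeriv L n Ψ.ψ Y i‖ ^ 2 := (hK.norm).pow 2
  -- torus integration by parts: `|k|² ∫ cos θᵢ |Ψ|² = -∫ sin θᵢ 2⟨Ψ, k·∇ᵢΨ⟩`
  have hIBP : ksq L n * ∫ X in cellN N L, cos (phase L n X i) * ‖Ψ.ψ X‖ ^ 2 =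
      -∫ X in cellN N L, sin (phase L n X i) * (2 * ⟪Ψ.ψ X, kDeriv L n Ψ.ψ X i⟫) := by
    have h0 : ∫ Y in cellN N L, (ksq L n * (cos (phase L n Y i) * ‖Ψ.ψ Y‖ ^ 2) +
        sin (phase L n Y i) * (2 * ⟪Ψ.ψ Y, kDeriv L n Ψ.ψ Y i⟫)) = 0 := by
      rw [← integral_fderiv_apply_single_kvec_eq_zero hL n
        (contDiff_sin_phase_mul_norm_sq L n Ψ.contDiff i)
        (isLatticePeriodic_sin_phase_mul_norm_sq L n Ψ.periodic i) i]
      refine integral_congr_ae (Eventually.of_forall fun Y => ?_)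
      show _ = fderiv ℝ (fun Y => sin (phase L n Y i) * ‖Ψ.ψ Y‖ ^ 2) Y (Pi.single i (kvec L n))
      rw [fderiv_sin_phase_mul_norm_sq L n ((Ψ.contDiff.differentiable one_ne_zero) Y) i]
      ring
    rw [integral_add ((integrableOn_cellN hf L).const_mul _) (integrableOn_cellN hg L),
      integral_const_mul] at h0
    linarith
  -- `∫ |k·∇ᵢΨ|² ≤ |k|² T(Ψ)` (Cauchy–Schwarz in the coordinates of particle `i`, others added)
  have hDle : ∫ Y in cellN N L, ‖kDeriv L n Ψ.ψ Y i‖ ^ 2 ≤ ksq L n * cellKineticEnergy L Ψ.ψ := by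
    rw [cellKineticEnergy, ← integral_const_mul]
    refine integral_mono (integrableOn_cellN hD L)
      ((integrableOn_cellN (continuous_kineticDensityReal Ψ.contDiff) L).const_mul _) fun Y => ?_
    refine (norm_kDeriv_sq_le L n Ψ.ψ Y i).trans (mul_le_mul_of_nonneg_left ?_ hq)
    exact Finset.single_le_sum (f := fun i' : Fin N =>
        ∑ c : Fin 3, ‖fderiv ℝ Ψ.ψ Y (Pi.single i' (EuclideanSpace.single c (1 : ℝ)))‖ ^ 2)
      (fun _ _ => Finset.sum_nonneg fun _ _ => sq_nonneg _) (Finset.mem_univ i)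
  calc ksq L n * |∫ X in cellN N L, cos (phase L n X i) * ‖Ψ.ψ X‖ ^ 2|
      = |∫ X in cellN N L, sin (phase L n X i) * (2 * ⟪Ψ.ψ X, kDeriv L n Ψ.ψ X i⟫)| := by
        rw [← abs_of_nonneg hq, ← abs_mul, hIBP, abs_neg]
    _ ≤ ∫ X in cellN N L, |sin (phase L n X i) * (2 * ⟪Ψ.ψ X, kDeriv L n Ψ.ψ X i⟫)| :=
        abs_integral_le_integral_abs
    _ ≤ ∫ X in cellN N L, (γ * (sin (phase L n X i) ^ 2 * ‖Ψ.ψ X‖ ^ 2) +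
          ‖kDeriv L n Ψ.ψ X i‖ ^ 2 / γ) :=
        integral_mono (integrableOn_cellN hg L).abs
          (((integrableOn_cellN hS L).const_mul γ).add ((integrableOn_cellN hD L).div_const γ))
          fun X => abs_sin_mul_two_inner_le _ _ _ hγ
    _ = γ * (∫ X in cellN N L, sin (phase L n X i) ^ 2 * ‖Ψ.ψ X‖ ^ 2) +
          (∫ X in cellN N L, ‖kDeriv L n Ψ.ψ X i‖ ^ 2) / γ := by
        rw [integral_add ((integrableOn_cellN hS L).const_mul γ)
          ((integrableOn_cellN hD L).div_const γ), integral_const_mul, integral_div]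
    _ ≤ γ * (∫ X in cellN N L, sin (phase L n X i) ^ 2 * ‖Ψ.ψ X‖ ^ 2) +
          (ksq L n * cellKineticEnergy L Ψ.ψ) / γ := by gcongr
    _ = _ := by ring

/-! ### The two moments of the transported state: flattening and collapse -/

/-- FLATTENED COSINE MOMENT: `∫_cell cos θᵢ |Φ^τ|² = ∫_cell cos(θᵢ + δ(τ, θᵢ)) |Φ|²` (`cos θᵢ`
is lattice periodic; Bochner torus change of variables). [folklore] -/
theorem integral_cos_mul_norm_sq_transportFun (hL : 0 < L) (hk : ksq L n ≠ 0)
    (Φ : PeriodicTrialState N L) (τ : ℝ) (i : Fin N) :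
    ∫ X in cellN N L, cos (phase L n X i) * ‖transportFun L n τ Φ.ψ X‖ ^ 2 =
      ∫ Y in cellN N L, cos (phase L n Y i + angleFlow τ (phase L n Y i)) * ‖Φ.ψ Y‖ ^ 2 := by
  rw [integral_mul_norm_sq_transportFun hL hk τ Φ.periodic (fun X j c => by
    obtain ⟨m, hm⟩ := exists_phase_add_single L n X j c i
    rw [hm, cos_add_int_mul_two_pi])]
  simp_rw [phase_transportFlow hk]

/-- FLATTENED SINE-SQUARED MOMENT: `∫_cell sin² θᵢ |Φ^τ|² = ∫_cell sin²(θᵢ + δ(τ, θᵢ)) |Φ|²`.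
[folklore] -/
theorem integral_sin_sq_mul_norm_sq_transportFun (hL : 0 < L) (hk : ksq L n ≠ 0)
    (Φ : PeriodicTrialState N L) (τ : ℝ) (i : Fin N) :
    ∫ X in cellN N L, sin (phase L n X i) ^ 2 * ‖transportFun L n τ Φ.ψ X‖ ^ 2 =
      ∫ Y in cellN N L, sin (phase L n Y i + angleFlow τ (phase L n Y i)) ^ 2 * ‖Φ.ψ Y‖ ^ 2 := by
  rw [integral_mul_norm_sq_transportFun hL hk τ Φ.periodic (fun X j c => by
    obtain ⟨m, hm⟩ := exists_phase_add_single L n X j c i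
    rw [hm, sin_add_int_mul_two_pi])]
  simp_rw [phase_transportFlow hk]

/-- Off a Lebesgue-null set of configurations `sin θᵢ ≠ 0`: the exceptional set is the preimage
of the countable set `πℤ` under the surjective linear functional `Y ↦ k·yᵢ` (for `|k|² ≠ 0`).
[folklore] -/
theorem ae_sin_phase_ne_zero (hk : ksq L n ≠ 0) (i : Fin N) :
    ∀ᵐ Y : Config N, sin (phase L n Y i) ≠ 0 := by
  let T : Config N →ₗ[ℝ] ℝ := (kdual L n : Space →ₗ[ℝ] ℝ).comp (LinearMap.proj i)
  have hT : Function.Surjective T := fun r =>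
    ⟨Pi.single i ((r / ksq L n) • kvec L n), by
      simp only [T, LinearMap.coe_comp, Function.comp_apply, LinearMap.proj_apply,
        Pi.single_eq_same, ContinuousLinearMap.coe_coe, map_smul, kdual_kvec, smul_eq_mul]
      exact div_mul_cancel₀ r hk⟩
  have hs : MeasurableSet {y : ℝ | sin y ≠ 0} :=
    (continuous_sin.measurable (measurableSet_singleton (0 : ℝ))).compl
  have hc : ({y : ℝ | sin y = 0}).Countable :=
    (countable_range fun m : ℤ => (m : ℝ) * π).mono fun y hy => sin_eq_zero_iff.1 hy
  have hae : ∀ᵐ y : ℝ, y ∈ {y : ℝ | sin y ≠ 0} := (hc.ae_notMem volume).mono fun y hy => hy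
  filter_upwards [(ae_comp_linearMap_mem_iff T volume volume hT hs).2 hae] with Y hY using hY

/-- `sin θ ≠ 0` excludes both attracting planes: `-1 < cos θ < 1`. [folklore] -/
theorem abs_cos_lt_one_of_sin_ne_zero {θ : ℝ} (h : sin θ ≠ 0) : -1 < cos θ ∧ cos θ < 1 := by
  have h2 : 0 < sin θ ^ 2 := by positivity
  have h3 : cos θ ^ 2 < 1 := by nlinarith [sin_sq_add_cos_sq θ]
  constructor <;> nlinarith [h3]

/-- CLOSED FORM towards `+∞`:
`(1 + cos(θ + δ(τ,θ))) · ((1 + cos θ) + e^{2τ}(1 - cos θ)) = 2 (1 + cos θ)` (cosine boost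
formula with `cosh τ ∓ sinh τ = e^{∓τ}`). [folklore] -/
theorem one_add_cos_add_angleFlow_mul (τ θ : ℝ) :
    (1 + cos (θ + angleFlow τ θ)) * (1 + cos θ + exp τ ^ 2 * (1 - cos θ)) = 2 * (1 + cos θ) := by
  have hc := cos_add_angleFlow_mul τ θ
  have hE := exp_pos τ
  have hJ : 2 * exp τ * (cosh τ - cos θ * sinh τ) = 1 + cos θ + exp τ ^ 2 * (1 - cos θ) := by
    rw [cosh_eq, sinh_eq, exp_neg]; field_simp; ring
  have hK : 2 * exp τ * (cos θ * cosh τ - sinh τ) = 1 + cos θ - (1 - cos θ) * exp τ ^ 2 := by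
    rw [cosh_eq, sinh_eq, exp_neg]; field_simp; ring
  linear_combination (-cos (θ + angleFlow τ θ)) * hJ + (2 * exp τ) * hc + hK

/-- CLOSED FORM towards `-∞`:
`(1 - cos(θ + δ(τ,θ))) · ((1 - cos θ) + e^{-2τ}(1 + cos θ)) = 2 (1 - cos θ)`. [folklore] -/
theorem one_sub_cos_add_angleFlow_mul (τ θ : ℝ) :
    (1 - cos (θ + angleFlow τ θ)) * (1 - cos θ + exp (-τ) ^ 2 * (1 + cos θ)) = 2 * (1 - cos θ) := by
  have hc := cos_add_angleFlow_mul τ θ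
  have hE := exp_pos τ
  have hJ : 2 * exp (-τ) * (cosh τ - cos θ * sinh τ) = 1 - cos θ + exp (-τ) ^ 2 * (1 + cos θ) := by
    rw [cosh_eq, sinh_eq, exp_neg]; field_simp; ring
  have hK : 2 * exp (-τ) * (cos θ * cosh τ - sinh τ) = cos θ - 1 + exp (-τ) ^ 2 * (1 + cos θ) := by
    rw [cosh_eq, sinh_eq, exp_neg]; field_simp; ring
  linear_combination (cos (θ + angleFlow τ θ)) * hJ - (2 * exp (-τ)) * hc - hK

/-- POINTWISE COLLAPSE towards `+∞`: `1 + cos(θ + δ(τ,θ)) → 0` as `τ → +∞` when `cos θ < 1`.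
[folklore] -/
theorem tendsto_one_add_cos_add_angleFlow_atTop {θ : ℝ} (h : cos θ < 1) :
    Tendsto (fun τ => 1 + cos (θ + angleFlow τ θ)) atTop (𝓝 0) := by
  have hb : 0 < 1 - cos θ := sub_pos.2 h
  have ha : 0 ≤ 1 + cos θ := by linarith [neg_one_le_cos θ]
  have hden : ∀ τ, 0 < 1 + cos θ + exp τ ^ 2 * (1 - cos θ) := fun τ => by positivity
  have heq : (fun τ => 1 + cos (θ + angleFlow τ θ)) =
      fun τ => 2 * (1 + cos θ) / (1 + cos θ + exp τ ^ 2 * (1 - cos θ)) := by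
    funext τ
    rw [eq_div_iff (hden τ).ne', one_add_cos_add_angleFlow_mul]
  rw [heq]
  refine Tendsto.div_atTop tendsto_const_nhds ?_
  refine tendsto_atTop_add_const_left _ _ (Tendsto.atTop_mul_const hb ?_)
  exact (tendsto_pow_atTop two_ne_zero).comp tendsto_exp_atTop

/-- POINTWISE COLLAPSE towards `-∞`: `1 - cos(θ + δ(τ,θ)) → 0` as `τ → -∞` when `-1 < cos θ`.
[folklore] -/
theorem tendsto_one_sub_cos_add_angleFlow_atBot {θ : ℝ} (h : -1 < cos θ) :
    Tendsto (fun τ => 1 - cos (θ + angleFlow τ θ)) atBot (𝓝 0) := by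
  have hb : 0 < 1 + cos θ := by linarith
  have ha : 0 ≤ 1 - cos θ := by linarith [cos_le_one θ]
  have hden : ∀ τ, 0 < 1 - cos θ + exp (-τ) ^ 2 * (1 + cos θ) := fun τ => by positivity
  have heq : (fun τ => 1 - cos (θ + angleFlow τ θ)) =
      fun τ => 2 * (1 - cos θ) / (1 - cos θ + exp (-τ) ^ 2 * (1 + cos θ)) := by
    funext τ
    rw [eq_div_iff (hden τ).ne', one_sub_cos_add_angleFlow_mul]
  rw [heq]
  refine Tendsto.div_atTop tendsto_const_nhds ?_
  refine tendsto_atTop_add_const_left _ _ (Tendsto.atTop_mul_const hb ?_)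
  exact (tendsto_pow_atTop two_ne_zero).comp (tendsto_exp_atTop.comp tendsto_neg_atBot_atTop)

/-- DOMINATED CONVERGENCE ON THE CELL: a continuous weight `w_τ` with `|w_τ| ≤ 2` collapsing
almost everywhere on the cell along a countably generated filter has `∫_cell w_τ |Φ|² → 0`
(dominated by `2|Φ|²`). [folklore] -/
theorem tendsto_integral_weight_mul_norm_sq {l : Filter ℝ} [l.IsCountablyGenerated]
    (Φ : PeriodicTrialState N L) {w : ℝ → Config N → ℝ} (hc : ∀ τ, Continuous (w τ))
    (hb : ∀ τ Y, |w τ Y| ≤ 2)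
    (hlim : ∀ᵐ Y ∂(volume.restrict (cellN N L)), Tendsto (fun τ => w τ Y) l (𝓝 0)) :
    Tendsto (fun τ => ∫ Y in cellN N L, w τ Y * ‖Φ.ψ Y‖ ^ 2) l (𝓝 0) := by
  have hρ : Continuous fun Y => ‖Φ.ψ Y‖ ^ 2 := (Φ.contDiff.continuous.norm).pow 2
  have h := tendsto_integral_filter_of_dominated_convergence (μ := volume.restrict (cellN N L))
    (l := l) (F := fun τ Y => w τ Y * ‖Φ.ψ Y‖ ^ 2) (f := fun _ => 0) (fun Y => 2 * ‖Φ.ψ Y‖ ^ 2)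
    (Eventually.of_forall fun τ => ((hc τ).mul hρ).aestronglyMeasurable)
    (Eventually.of_forall fun τ => Eventually.of_forall fun Y => by
      rw [Real.norm_eq_abs, abs_mul, abs_of_nonneg (sq_nonneg ‖Φ.ψ Y‖)]
      exact mul_le_mul_of_nonneg_right (hb τ Y) (sq_nonneg _))
    ((integrableOn_cellN hρ L).const_mul 2)
    (by
      filter_upwards [hlim] with Y hY
      simpa using hY.mul_const (‖Φ.ψ Y‖ ^ 2))
  simpa using h

/-! ### Coercivity -/

/-- **THE COERCIVITY ESTIMATE along a filter.** For `L > 0`, `n ≠ 0`, a particle `i`, a sign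
`σ = ±1` and a countably generated filter `l` on the flow times along which
`1 + σ cos(θ + δ(τ, θ)) → 0` whenever `sin θ ≠ 0` (`σ = 1, l = atTop`; `σ = -1, l = atBot`):
eventually along `l`, `∫_cell |∇Φ^τ|² ≥ B`. Assembly of the uncertainty lemma for `Φ^τ`, the
flattening, and the collapse `G(τ) = ∫ (1 + σ cos(θᵢ + δ)) |Φ|² → 0` (`|∫cos(θᵢ+δ)|Φ|²| ≥ 1 - G`,
`∫ sin²(θᵢ+δ)|Φ|² ≤ 2G`). [folklore] -/
theorem eventually_le_cellKineticEnergy_transportFun (hL : 0 < L) (hn : n ≠ 0)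
    (Φ : PeriodicTrialState N L) (i : Fin N) {l : Filter ℝ} [l.IsCountablyGenerated] {σ : ℝ}
    (hσ : σ = 1 ∨ σ = -1)
    (hlim : ∀ θ : ℝ, sin θ ≠ 0 → Tendsto (fun τ => 1 + σ * cos (θ + angleFlow τ θ)) l (𝓝 0))
    (B : ℝ) : ∀ᶠ τ in l, B ≤ cellKineticEnergy L (transportFun L n τ Φ.ψ) := by
  have hq : 0 < ksq L n := ksq_pos hL.ne' hn
  have hk : ksq L n ≠ 0 := hq.ne'
  -- the parameter of the uncertainty lemma
  set γ : ℝ := max B 0 + 1 with hγdef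
  have hγ : 0 < γ := by positivity
  have hBγ : B ≤ γ - 1 := by rw [hγdef]; linarith [le_max_left B 0]
  -- pointwise facts on the weight `1 + σ cos x`
  have hw : ∀ x : ℝ, 0 ≤ 1 + σ * cos x ∧ 1 + σ * cos x ≤ 2 ∧ sin x ^ 2 ≤ 2 * (1 + σ * cos x) := by
    intro x
    rcases hσ with rfl | rfl
    · refine ⟨?_, ?_, ?_⟩ <;>
        nlinarith [neg_one_le_cos x, cos_le_one x, sin_sq_add_cos_sq x, sq_nonneg (1 + cos x)]
    · refine ⟨?_, ?_, ?_⟩ <;>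
        nlinarith [neg_one_le_cos x, cos_le_one x, sin_sq_add_cos_sq x, sq_nonneg (1 - cos x)]
  -- continuity facts
  have hθ : Continuous fun Y : Config N => phase L n Y i := continuous_phase L n i
  have hδ : ∀ τ : ℝ, Continuous fun Y : Config N => phase L n Y i + angleFlow τ (phase L n Y i) :=
    fun τ => hθ.add ((contDiff_angleFlow_right (m := 0) τ).continuous.comp hθ)
  have hρ : Continuous fun Y => ‖Φ.ψ Y‖ ^ 2 := (Φ.contDiff.continuous.norm).pow 2
  have hWc : ∀ τ : ℝ, Continuous fun Y : Config N =>
      1 + σ * cos (phase L n Y i + angleFlow τ (phase L n Y i)) := fun τ =>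
    continuous_const.add (continuous_const.mul (continuous_cos.comp (hδ τ)))
  -- the collapsing moment
  set G : ℝ → ℝ := fun τ => ∫ Y in cellN N L,
    (1 + σ * cos (phase L n Y i + angleFlow τ (phase L n Y i))) * ‖Φ.ψ Y‖ ^ 2 with hGdef
  have hGlim : Tendsto G l (𝓝 0) := by
    refine tendsto_integral_weight_mul_norm_sq Φ hWc (fun τ Y => ?_) ?_
    · have h3 := hw (phase L n Y i + angleFlow τ (phase L n Y i))
      exact abs_le.2 ⟨by linarith [h3.1], h3.2.1⟩
    · filter_upwards [ae_restrict_of_ae (s := cellN N L) (ae_sin_phase_ne_zero hk i)] with Y hY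
        using hlim _ hY
  set c : ℝ := γ + 2 * γ ^ 2 / ksq L n with hcdef
  have hc : 0 < c := by positivity
  filter_upwards [(tendsto_order.1 hGlim).2 (1 / c) (by positivity)] with τ hτ
  -- the estimate at a fixed flow time: uncertainty for `Φ^τ`, flattened
  have hU := ksq_mul_abs_integral_cos_le hL n (Φ.transport hL hn τ) i hγ
  rw [PeriodicTrialState.transport_ψ, integral_cos_mul_norm_sq_transportFun hL hk Φ τ i,
    integral_sin_sq_mul_norm_sq_transportFun hL hk Φ τ i] at hU
  set A : ℝ := ∫ Y in cellN N L, cos (phase L n Y i + angleFlow τ (phase L n Y i)) * ‖Φ.ψ Y‖ ^ 2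
  set S : ℝ := ∫ Y in cellN N L, sin (phase L n Y i + angleFlow τ (phase L n Y i)) ^ 2 * ‖Φ.ψ Y‖ ^ 2
  have hAc : Continuous fun Y : Config N =>
      cos (phase L n Y i + angleFlow τ (phase L n Y i)) * ‖Φ.ψ Y‖ ^ 2 :=
    (continuous_cos.comp (hδ τ)).mul hρ
  have hSc : Continuous fun Y : Config N =>
      sin (phase L n Y i + angleFlow τ (phase L n Y i)) ^ 2 * ‖Φ.ψ Y‖ ^ 2 :=
    ((continuous_sin.comp (hδ τ)).pow 2).mul hρ
  -- `G = 1 + σ A`, `S ≤ 2 G`, `0 ≤ G`, hence `1 - G ≤ |A|`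
  have hGA : G τ = 1 + σ * A := by
    calc G τ = ∫ Y in cellN N L, (‖Φ.ψ Y‖ ^ 2 +
          σ * (cos (phase L n Y i + angleFlow τ (phase L n Y i)) * ‖Φ.ψ Y‖ ^ 2)) :=
          integral_congr_ae (Eventually.of_forall fun Y => by ring)
      _ = 1 + σ * A := by
          rw [integral_add (integrableOn_cellN hρ L) ((integrableOn_cellN hAc L).const_mul σ),
            integral_const_mul, integral_norm_sq_eq_one]
  have hSG : S ≤ 2 * G τ := by
    rw [hGdef, ← integral_const_mul]
    refine integral_mono (integrableOn_cellN hSc L)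
      ((integrableOn_cellN ((hWc τ).mul hρ) L).const_mul 2) fun Y => ?_
    have h3 := (hw (phase L n Y i + angleFlow τ (phase L n Y i))).2.2
    have hρ0 : 0 ≤ ‖Φ.ψ Y‖ ^ 2 := sq_nonneg _
    calc sin (phase L n Y i + angleFlow τ (phase L n Y i)) ^ 2 * ‖Φ.ψ Y‖ ^ 2
        ≤ 2 * (1 + σ * cos (phase L n Y i + angleFlow τ (phase L n Y i))) * ‖Φ.ψ Y‖ ^ 2 :=
          mul_le_mul_of_nonneg_right h3 hρ0
      _ = _ := by ring
  have hG0 : 0 ≤ G τ := integral_nonneg fun Y => mul_nonneg (hw _).1 (sq_nonneg _)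
  have hA : 1 - G τ ≤ |A| := by
    rw [hGA]
    rcases hσ with rfl | rfl
    · rw [one_mul]; linarith [neg_abs_le A]
    · rw [neg_one_mul]; linarith [le_abs_self A]
  -- algebra: `T ≥ γ|A| - (γ²/|k|²) S ≥ γ(1 - G) - (2γ²/|k|²) G = γ - G c > γ - 1 ≥ B`
  have h1 : γ * |A| ≤ γ ^ 2 / ksq L n * S + cellKineticEnergy L (transportFun L n τ Φ.ψ) := by
    have h := mul_le_mul_of_nonneg_left hU (div_pos hγ hq).le
    have e1 : γ / ksq L n * (ksq L n * |A|) = γ * |A| := by field_simp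
    have e2 : γ / ksq L n * (γ * S + ksq L n / γ * cellKineticEnergy L (transportFun L n τ Φ.ψ)) =
        γ ^ 2 / ksq L n * S + cellKineticEnergy L (transportFun L n τ Φ.ψ) := by field_simp
    rwa [e1, e2] at h
  have h2 : γ * (1 - G τ) ≤ γ * |A| := mul_le_mul_of_nonneg_left hA hγ.le
  have h3 : γ ^ 2 / ksq L n * S ≤ γ ^ 2 / ksq L n * (2 * G τ) :=
    mul_le_mul_of_nonneg_left hSG (by positivity)
  have h4 : G τ * c < 1 := by rwa [lt_div_iff₀ hc] at hτ
  have h5 : G τ * c = γ * G τ + γ ^ 2 / ksq L n * (2 * G τ) := by rw [hcdef]; ring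
  linarith

/-- **COERCIVITY towards `+∞`**: `∫_cell |∇Φ^τ|² → +∞` as `τ → +∞` (`N ≥ 1`). [folklore] -/
theorem tendsto_cellKineticEnergy_transportFun_atTop (hL : 0 < L) (hn : n ≠ 0) (hN : 1 ≤ N)
    (Φ : PeriodicTrialState N L) :
    Tendsto (fun τ => cellKineticEnergy L (transportFun L n τ Φ.ψ)) atTop atTop :=
  tendsto_atTop.2 fun B => eventually_le_cellKineticEnergy_transportFun hL hn Φ ⟨0, hN⟩
    (l := atTop) (σ := 1) (Or.inl rfl) (fun θ hθ => by
      simpa using tendsto_one_add_cos_add_angleFlow_atTop (abs_cos_lt_one_of_sin_ne_zero hθ).2) B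

/-- **COERCIVITY towards `-∞`**: `∫_cell |∇Φ^τ|² → +∞` as `τ → -∞` (`N ≥ 1`). [folklore] -/
theorem tendsto_cellKineticEnergy_transportFun_atBot (hL : 0 < L) (hn : n ≠ 0) (hN : 1 ≤ N)
    (Φ : PeriodicTrialState N L) :
    Tendsto (fun τ => cellKineticEnergy L (transportFun L n τ Φ.ψ)) atBot atTop :=
  tendsto_atTop.2 fun B => eventually_le_cellKineticEnergy_transportFun hL hn Φ ⟨0, hN⟩
    (l := atBot) (σ := -1) (Or.inr rfl) (fun θ hθ => by
      simpa [sub_eq_add_neg] using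
        tendsto_one_sub_cos_add_angleFlow_atBot (abs_cos_lt_one_of_sin_ne_zero hθ).1) B

/-! ### The registered sub-goal -/

/-- **Registered sub-goal `stub_transportCoercive` of S1** (line `force-balance-constitutive`, crux
stmt-AtomisticToContinuum-9481): for `L > 0`, a mode `n ≠ 0`, `N ≥ 1` particles and an admissible
periodic state `Φ`, the kinetic energy of the transported wave function
`Φ^τ = transportFun L n τ Φ.ψ` is COERCIVE in the flow time: for every level `B` there is `T` with
`ofReal B ≤ ∫⁻_cell |∇Φ^τ|²` for all `τ ≥ T`, and a `T` with the same for all `τ ≤ -T`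
(whence `τ ↦ E_w(Φ^τ) - s·m(Φ^τ) ≥ ∫⁻_cell |∇Φ^τ|² - 2sN` attains its infimum). [folklore] -/
theorem stub_transportCoercive : ∀ (N : ℕ) (L : ℝ) (n : Fin 3 → ℤ), 0 < L → n ≠ 0 → 1 ≤ N →
    ∀ (Φ : Literature.MathematicalPhysics.QuantumManyBody.BoseGas.PeriodicTrialState N L) (B : ℝ),
    (∃ T : ℝ, ∀ τ : ℝ, T ≤ τ → ENNReal.ofReal B ≤
      ∫⁻ X in Literature.MathematicalPhysics.QuantumManyBody.BoseGas.cellN N L,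
        Literature.MathematicalPhysics.QuantumManyBody.BoseGas.kineticDensity
          (transportFun L n τ Φ.ψ) X) ∧
    (∃ T : ℝ, ∀ τ : ℝ, τ ≤ -T → ENNReal.ofReal B ≤
      ∫⁻ X in Literature.MathematicalPhysics.QuantumManyBody.BoseGas.cellN N L,
        Literature.MathematicalPhysics.QuantumManyBody.BoseGas.kineticDensity
          (transportFun L n τ Φ.ψ) X) := by
  intro N L n hL hn hN Φ B
  have key : ∀ τ : ℝ, B ≤ cellKineticEnergy L (transportFun L n τ Φ.ψ) →
      ENNReal.ofReal B ≤ ∫⁻ X in cellN N L, kineticDensity (transportFun L n τ Φ.ψ) X :=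
    fun τ h => by
      rw [lintegral_kineticDensity_eq (contDiff_transportFun L n τ Φ.contDiff) L]
      exact ENNReal.ofReal_le_ofReal h
  refine ⟨?_, ?_⟩
  · obtain ⟨T, hT⟩ := eventually_atTop.1
      (tendsto_atTop.1 (tendsto_cellKineticEnergy_transportFun_atTop hL hn hN Φ) B)
    exact ⟨T, fun τ hτ => key τ (hT τ hτ)⟩
  · obtain ⟨T, hT⟩ := eventually_atBot.1
      (tendsto_atTop.1 (tendsto_cellKineticEnergy_transportFun_atBot hL hn hN Φ) B)
    exact ⟨-T, fun τ hτ => key τ (hT τ (by linarith))⟩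

end

end Summit.AtomisticToContinuum.BoseEinsteinCondensation.Cruxes.DensityResponse.ForceBalanceConstitutive
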